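import Mathlib
import Summits.Langlands.Langlands.Theses.PhantomRMYoshida
import Literature.NumberTheory.GaloisRepresentations.SerreWeight
import Literature.NumberTheory.GaloisRepresentations.ResidualPair
import Literature.NumberTheory.Automorphic.AdicCompletionLocalField
import Literature.NumberTheory.DiophantineGeometry.AVGaloisModule
import Literature.NumberTheory.DiophantineGeometry.AbelianVarietyOrdinaryReduction

/-!
# Line `level-three-weierstrass-switch` — checked skeleton for the crux
`Summit.Langlands.Langlands.Theses.PhantomRMYoshida.StableYoshidaCongruence` (stmt-Langlands-13640)

Planner crux-plan, round 1 (idea card `level-three-weierstrass-switch`, ideator 2; triage r1: pass ×3,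
merge ≈ `burkhardt-weddle-two-three-anchor`; line card `Lines/level-three-weierstrass-switch.md`).

## The line (p = 3 sector lever, in print)

The crux asks, for every odd `p` and every eligible residual Yoshida pair `(σ̄, σ̄')` with SOME
Greenberg-ordinary `p`-distinguished symplectic-`ε⁻¹` lift `ρ` (H5, possibly reducible), for an
IRREDUCIBLE AUTOMORPHIC lift `ρ₀` of the same shape.  Expected dimension of the relevant deformation
problem is `-1` (Disproof.lean §6): lifts are accidents — motives or functorial constructions.  This
line supplies the MOTIVE when one is available for free: at `p = 3` the twisted moduli space
`P(ρ̄)` of principally polarised abelian surfaces with full level-`3` structure of type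
`ρ̄ : Γ_ℚ → GSp₄(𝔽₃)` is RATIONAL (a twist of the Burkhardt quartic; BoxerEtAl2021 §10.2,
"Weddle surface" presentation), so genus-2 curves with a rational Weierstrass point and
`Jac(X)[3] ≅ ρ̄` exist with prescribed behaviour at `2`, `3`, `∞` and away from a thin set
(BoxerCalegariGeePilloni2025 = arXiv:2502.20645, Lemma 9.4.1 (Ekedahl-type approximation on a
rational variety), Lemma 9.4.2 "switching", Remark 9.4.3/9.4.4): `B = Jac(X)` has `ρ̄_{B,3} ≅ ρ̄`,
good ordinary reduction at `3`, `End(B_ℚ̄) = ℤ`, and mod-`2` image `S₅(b)` with ordinary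
`2`-distinguished reduction at `2`, whence `B` is MODULAR by the 2-adic theorem
(arXiv:2502.20645 §8.3 main Theorem (held-text Thm 386) "residually `A₅(b)`", no hypothesis at `3`, exactly as in the first half
of the proof of Thm 9.5.2), and its weight-2 `π` on `GSp₄/ℚ` transfers to a cuspidal `Π` on `GL₄`
(Arthur / Gee–Taïbi, as in the statement of Thm 9.5.2).  Then `ρ₀ := H¹_ét(B_ℚ̄, ℚ̄₃)` (the
contragredient of the rational `3`-adic Tate module) is irreducible (Faltings + `End = ℤ`),
symplectic with multiplier `ε⁻¹` (Weil pairing), Greenberg-ordinary of shape `(0,0,1,1)` at `3`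
(Serre–Tate, good ordinary reduction), residually `σ̄ ⊕ σ̄'` (since `ρ̄_{B,3} ≅ ρ̄`), residually
`3`-distinguished (transferred from the H5-witness: distinguishedness is a property of the residual
pair — the ONLY place H5 is used), and automorphic: `CruxAt 3` holds on the sector, REDUCIBLE
witnesses included (the lever never looks at the witness beyond its residual shape at `3`).

THE SECTOR (`p = 3 ∧ Switchable 3 k σ σ'`): `σ̄ ⊕ σ̄'` admits a `GSp₄(𝔽₃)`-model `ρ̄` (both
`𝔽₃`-rational, or the phantom-RM case `σ̄' = σ̄^(3)` over `𝔽₉` — the route's motivating case)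
which is ordinary-with-unramified-sub and PEU RAMIFIÉ at `3` (= "`ρ̄^∨|_{Γ_{ℚ₃}}` ordinary and
finite flat", the hypothesis of Lemma 9.4.2: H5 alone allows très ramifié / multiplicative
witnesses, which are OUTSIDE the printed lemma — triage r1-1/r1-2 sharpening) and unramified at `2`
with `charpoly ρ̄(Frob₂) ≠ (X² ± X + 2)²` (the `4C/12C` condition in the form of Thm 9.5.2 (2)).
Outside the sector (all `p ≥ 5`: `A₂(p)`-twists are of general type, Hulek–Sankaran, no Diophantine
supply; and the `p = 3` pairs with no switchable model) the line says NOTHING: that is the honest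
remainder stub `stub_offSectorRemainder`, which is the crux restricted off the sector (regimes R4 and
the D-residue of Disproof §5) — NOT claimed by this line; the lead should hand it back
(`promote-stub`) or the tenure planner should restate the item (Irr' / sector), cf. all three
triage notes and Disproof `closes_irr'`.

## Shape (data flow of `StableYoshidaCongruence_of`, sorry-free glue at the end of the file)

`crux_iff` (`Iff.rfl`, Disproof §0 vocabulary re-declared here because `Cruxes/**` work files are
not importable) turns the crux into `∀ p ≠ 2, ∀ k red σ σ', CruxAt p k red σ σ'`; classical case
split on `p = 3 ∧ Switchable p k σ σ'`:
* in the sector: `stub_switchToModularSurface` (the 2–3 switch, XL, in print) gives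
  `B, b, ρ₀` with `TateFrame`, `dim B = 2`, good ordinary at `3`, `End = ℤ`, symplectic-`ε⁻¹`,
  `HasResidualPair red σ σ'`, `AutGL4`; `stub_tateModuleIrreducible` (Faltings) and
  `stub_tateModuleGreenberg` (Serre–Tate) — assembled as `tateModuleDictionary` — give irreducibility
  and the Greenberg shape; `stub_charpolyCongruence` (Chebotarev + continuity) and
  `stub_distinguishedTransferLocal` (local residual characters, Brauer–Nesbitt) — assembled as
  `distinguishedTransfer` — move residual distinguishedness from the H5-witness `ρ` to `ρ₀`;
  assemble `⟨ρ₀, irr, Sh, AutGL4⟩`;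
* off the sector: `stub_offSectorRemainder`.

LEAD RESHAPE (line lead prover-line-stmt-Langlands-13640-0, 2026-08-16): the planner's 4 stubs became 6
(≤ stubs_max 7) by splitting `stub_distinguishedTransfer` into its global/local halves and
`stub_tateModuleDictionary` along its two named-fact dependencies; the compositions are proved here, the
glue is otherwise byte-identical in logic.

## Disproof used (Cruxes/StableYoshidaCongruence/Disproof.lean, cdisprove cycle 3, read in full)

* §2 `exists_cuspForm_of_not_crux`: no `_false_without_H` theorem exists for this crux (the
  automorphic wall) — nothing to honour by name; the load-bearing analysis §4 is honoured instead:
  H5 (`∃ ρ, Sh ρ`) is THE load-bearing hypothesis and "only ever certifies the reducible witness" —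
  this line uses H5 exactly once, in `stub_distinguishedTransfer` (residual `3`-distinguishedness of
  `ρ₀`), and needs nothing else from the witness, which is why it covers the reducible-witness
  surplus (no Irr'-trap, §3.2); H1/H1' (`AutGL2`) are not consumed (decoration, §3.5
  `cruxNoAutAt_iff_of_KW`); H3/H4 are passed only to the remainder stub.
* §5 R2 is this line; R1/D1 (functorial pairs) and R4/D-residue are inside `stub_offSectorRemainder`.
* §6 "accidents only": the `+1` missing dimension is supplied by the rational moduli space, not by
  a lifting theorem — the barrier catalogue (NonRegularWeight / ResiduallyReducible /
  TaylorWilesNumericalCoincidence) constrains lifting METHODS and does not touch a motivic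
  construction (triage r1-1 on the sister card).
* Negative lemmas landed under `Theorems/StableYoshidaCongruence/Negative/`: none (nothing to
  import); negatives index: 1 unrelated entry (K3 Kuga–Satake); no stub is an instance of a refuted
  statement.
-/

set_option linter.dupNamespace false
set_option linter.unusedVariables false

noncomputable section

open CategoryTheory IsDedekindDomain
open scoped NumberField
open Literature.NumberTheory.GaloisRepresentations Literature.NumberTheory.Automorphic
open Literature.AlgebraicGeometry.Motives (AbelianVariety)
open Summit.Langlands.Langlands.Theses.PhantomRMYoshida

namespace Summit.Langlands.Langlands.Cruxes.StableYoshidaCongruence.LevelThreeWeierstrassSwitch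

/-! ## Vocabulary I — the crux unfolded into named pieces (verbatim Disproof.lean §0) -/

section Names

variable (p : ℕ) [Fact p.Prime] (k : Type) [Field k] [CharP k p] [TopologicalSpace k]
  [DiscreteTopology k]

/-- `ε̄ : Γ_ℚ → (ℤ/p)ˣ`, the mod-`p` cyclotomic character exactly as spelled in the route file. -/
def epsBar : Field.absoluteGaloisGroup ℚ →* (ZMod p)ˣ :=
  (modularCyclotomicCharacter (AlgebraicClosure ℚ)
      (HasEnoughRootsOfUnity.natCard_rootsOfUnity (AlgebraicClosure ℚ) p)).comp
    (MulSemiringAction.toRingAut (Field.absoluteGaloisGroup ℚ) (AlgebraicClosure ℚ))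

/-- The multiplier function `g ↦ ε(g)⁻¹ ∈ ℚ̄_p` of the route (cohomological convention). -/
def invCyc : Field.absoluteGaloisGroup ℚ → PadicAlgCl p := fun g =>
  algebraMap ℚ_[p] (PadicAlgCl p)
    ((((GaloisRep.cyclotomicCharacter ℚ p g)⁻¹ : ℤ_[p]ˣ) : ℤ_[p]) : ℚ_[p])

variable {p k}

/-- `Sh red σ σ' r`: the SHAPE demanded by the crux — symplectic-`ε⁻¹`, Greenberg-ordinary
`(0,0,1,1)` and residually distinguished at `p`, residual pair `(σ, σ')` through `red`.  Verbatim the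
route's `let Sh`; its third conjunct is literally `r.HasResidualPair red σ σ'`
(`Literature/NumberTheory/GaloisRepresentations/ResidualPair.lean`). -/
def Sh (red : Valued.integer (PadicAlgCl p) →+* k) (σ σ' : FramedGaloisRep ℚ k 2)
    (r : FramedGaloisRep ℚ (PadicAlgCl p) 4) : Prop :=
  r.IsSymplecticWithMultiplierFun (invCyc p) ∧
  (∀ v : HeightOneSpectrum (NumberField.RingOfIntegers ℚ),
      ((p : ℕ) : NumberField.RingOfIntegers ℚ) ∈ v.asIdeal →
        r.IsGreenbergOrdinaryOfShapeAt v ![0, 0, 1, 1] ∧ r.IsResiduallyDistinguishedAt v ![0, 0, 1, 1]) ∧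
  (∀ᶠ v : HeightOneSpectrum (NumberField.RingOfIntegers ℚ) in Filter.cofinite,
      r.IsUnramifiedAt v ∧ σ.IsUnramifiedAt v ∧ σ'.IsUnramifiedAt v ∧
        ∃ (P : Polynomial (Valued.integer (PadicAlgCl p))) (P₁ P₂ : Polynomial k),
          r.HasFrobCharpolyAt v (P.map (Valued.integer (PadicAlgCl p)).subtype) ∧
            σ.HasFrobCharpolyAt v P₁ ∧ σ'.HasFrobCharpolyAt v P₂ ∧ P.map red = P₁ * P₂)

/-- `AutGL2 red s`: residual automorphy of `s : Γ_ℚ → GL₂(k)` on `GL₂` (verbatim the route's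
`let AutGL2`; NOT consumed by this line — decoration modulo KW, Disproof §3.5). -/
def AutGL2 (red : Valued.integer (PadicAlgCl p) →+* k) (s : FramedGaloisRep ℚ k 2) : Prop :=
  ∀ (hcpt₂ : isCompact_glFiniteIntegralLevel 2 ℚ) (ι : PadicAlgCl p ≃+* ℂ),
    ∃ π₂ : CuspidalAutomorphicRepData 2 ℚ hcpt₂, π₂.1.IsLAlgebraic ∧
      ∀ᶠ v : HeightOneSpectrum (NumberField.RingOfIntegers ℚ) in Filter.cofinite,
        ∃ (a : Multiset ℂ) (P : Polynomial (Valued.integer (PadicAlgCl p))) (Pb : Polynomial k),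
          π₂.1.HasSatakeParamAt v a ∧
            P.map (Valued.integer (PadicAlgCl p)).subtype = arithFrobPolyOfSatake ι v.residueCard 1 a ∧
              s.IsUnramifiedAt v ∧ s.HasFrobCharpolyAt v Pb ∧ P.map red = Pb

variable (p) in
/-- `AutGL4 hcpt ι r`: `r` is automorphic on `GL₄(𝔸_ℚ)` (the inlined `IsAutomorphicAE` clause). -/
def AutGL4 (hcpt : isCompact_glFiniteIntegralLevel 4 ℚ) (ι : PadicAlgCl p ≃+* ℂ)
    (r : FramedGaloisRep ℚ (PadicAlgCl p) 4) : Prop :=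
  ∃ π : CuspidalAutomorphicRepData 4 ℚ hcpt, π.1.IsLAlgebraic ∧
    ∀ᶠ v : HeightOneSpectrum (NumberField.RingOfIntegers ℚ) in Filter.cofinite,
      ∃ a : Multiset ℂ, π.1.HasSatakeParamAt v a ∧ r.IsUnramifiedAt v ∧
        r.HasFrobCharpolyAt v (arithFrobPolyOfSatake ι v.residueCard 1 a)

variable (p) in
/-- `DetCond σ σ'`: `det σ = ε̄⁻¹` and `det σ' = det σ`. -/
def DetCond (σ σ' : FramedGaloisRep ℚ k 2) : Prop :=
  ∀ g, FramedRep.det σ g = (Units.map (ZMod.castHom (dvd_refl p) k).toMonoidHom (epsBar p g))⁻¹ ∧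
    FramedRep.det σ' g = FramedRep.det σ g

/-- `NonConj σ σ'`: `σ'` is not `GL₂(k)`-conjugate to `σ`. -/
def NonConj (σ σ' : FramedGaloisRep ℚ k 2) : Prop :=
  ¬ ∃ g : GL (Fin 2) k, ∀ x, g * σ x * g⁻¹ = σ' x

variable (p k) in
/-- The crux AT fixed outer data `(p, k, red, σ, σ')`. -/
def CruxAt (red : Valued.integer (PadicAlgCl p) →+* k) (σ σ' : FramedGaloisRep ℚ k 2) : Prop :=
  AutGL2 red σ → AutGL2 red σ' → σ.toGaloisRep.IsIrreducible → σ'.toGaloisRep.IsIrreducible →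
    DetCond p σ σ' → NonConj σ σ' → (∃ ρ : FramedGaloisRep ℚ (PadicAlgCl p) 4, Sh red σ σ' ρ) →
      ∀ (hcpt : isCompact_glFiniteIntegralLevel 4 ℚ) (ι : PadicAlgCl p ≃+* ℂ),
        ∃ ρ₀ : FramedGaloisRep ℚ (PadicAlgCl p) 4,
          ρ₀.toGaloisRep.IsIrreducible ∧ Sh red σ σ' ρ₀ ∧ AutGL4 p hcpt ι ρ₀

end Names

/-- The crux is literally `∀ p ≠ 2, ∀ k red σ σ', CruxAt p k red σ σ'` (the route's `let`s
zeta-reduce to the named pieces; same `Iff.rfl` as Disproof.lean `crux_iff`). -/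
theorem crux_iff :
    StableYoshidaCongruence ↔
      ∀ (p : ℕ) [Fact p.Prime], p ≠ 2 → ∀ (k : Type) [Field k] [CharP k p] [IsAlgClosed k]
        [TopologicalSpace k] [DiscreteTopology k] (red : Valued.integer (PadicAlgCl p) →+* k)
        (σ σ' : FramedGaloisRep ℚ k 2), CruxAt p k red σ σ' :=
  Iff.rfl

/-! ## Vocabulary II — the sector: switchable `GSp₄(𝔽_p)`-models (BCGP2025 Lemma 9.4.2 hypotheses) -/

section Sector

variable (p : ℕ) [Fact p.Prime] (k : Type) [Field k] [CharP k p] [TopologicalSpace k]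
  [DiscreteTopology k]

/-- Extension of scalars `𝔽_p → k` of an `𝔽_p`-valued framed representation (same spelling as the
route's `PhantomRMTransport`). -/
def toK (ρb : FramedGaloisRep ℚ (ZMod p) 4) : FramedGaloisRep ℚ k 4 :=
  FramedRep.baseChange (ZMod.castHom (dvd_refl p) k) continuous_of_discreteTopology ρb

variable {p k}

/-- `IsModelOf ρb σ σ'`: `ρb : Γ_ℚ → GL₄(𝔽_p)` is an `𝔽_p`-MODEL of `σ ⊕ σ'`, i.e. `ρb ⊗_{𝔽_p} k` is
`GL₄(k)`-conjugate to the block-diagonal `σ ⊕ σ'` (so the model is residually split; for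
`σ' = σ^(p)` over `𝔽_{p²}` it is `Res_{𝔽_{p²}/𝔽_p} σ`, for `σ, σ'` both `𝔽_p`-rational it is the
orthogonal sum). -/
def IsModelOf (ρb : FramedGaloisRep ℚ (ZMod p) 4) (σ σ' : FramedGaloisRep ℚ k 2) : Prop :=
  ∃ h : GL (Fin 4) k, ∀ x,
    (h⁻¹ * toK p k ρb x * h).val =
      Matrix.reindex finSumFinEquiv finSumFinEquiv (Matrix.fromBlocks (σ x).val 0 0 (σ' x).val)

variable (p) in
/-- `IsOrdinaryFlatAt v ρb` (`v ∣ p`): the local representation `ρb|_{Γ_{ℚ_v}}` is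
(i) ORDINARY WITH UNRAMIFIED SUB — in some frame it is block upper-triangular with inertia acting
trivially on the first `2 × 2` diagonal block and through the scalar `ε̄⁻¹` on the second (this is
"`ρb^∨|_{Γ_{ℚ_p}}` ordinary" in BCGP's convention `ρ̄^∨ ≅ A[p]`: multiplicative sub, étale
quotient), and (ii) PEU RAMIFIÉE (tree `ModPGaloisRep.IsPeuRamifie`: every upper ramification group
`I^u`, `u > 1`, acts trivially).  For an ordinary-shaped `ρb` and `p` odd, (ii) is equivalent to
"`ρb^∨|_{Γ_{ℚ_p}}` finite flat" (the cross classes live in `H¹(ℚ_p, ε̄ ⊗ unr)`, whose unit = flat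
Kummer classes have upper break `1/(p-1) ≤ 1` and whose non-unit classes have break `1 + 1/(p-1)`;
Serre 1987 §2.4, Fontaine 1985 Thm A) — so (i)+(ii) is EXACTLY the hypothesis
"`ρ̄^∨|_{G_{ℚ₃}}` is ordinary and finite flat" of arXiv:2502.20645 Lemma 9.4.2; this translation is
part of `stub_switchToModularSurface`'s obligation. -/
def IsOrdinaryFlatAt (v : HeightOneSpectrum (𝓞 ℚ)) (ρb : FramedGaloisRep ℚ (ZMod p) 4) : Prop :=
  ModPGaloisRep.IsPeuRamifie (ρb.toLocal v) ∧
  ∃ g : GL (Fin 4) (ZMod p),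
    (∀ (τ : Field.absoluteGaloisGroup (v.adicCompletion ℚ)) (i j : Fin 4), 2 ≤ (i : ℕ) → (j : ℕ) < 2 →
        (g * ρb.toLocal v τ * g⁻¹).val i j = 0) ∧
    (∀ τ ∈ absInertia (v.adicCompletion ℚ), ∀ i j : Fin 4, (i : ℕ) < 2 → (j : ℕ) < 2 →
        (g * ρb.toLocal v τ * g⁻¹).val i j = if i = j then 1 else 0) ∧
    (∀ τ ∈ absInertia (v.adicCompletion ℚ), ∀ i j : Fin 4, 2 ≤ (i : ℕ) → 2 ≤ (j : ℕ) →
        (g * ρb.toLocal v τ * g⁻¹).val i j =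
          if i = j then (((epsBar p (absGaloisRestrict ℚ (v.adicCompletion ℚ) τ))⁻¹ : (ZMod p)ˣ) : ZMod p)
          else 0)

variable (p) in
/-- `IsSwitchableAtTwo v ρb` (`v ∣ 2`): `ρb` is unramified at `2` and the characteristic polynomial of
`ρb(Frob₂)` is not `(X² ± X + 2)²` — for `p = 3` this is condition (2) of arXiv:2502.20645 Thm 9.5.2,
equivalent (ibid. and Lemma 9.4.2 (1)) to "the image of `ρ̄(Frob₂)` in `PGSp₄(𝔽₃) ∖ PSp₄(𝔽₃)` is
not of class `4C` or `12C`" and to the existence of a `2`-adic ordinary `2`-distinguished genus-2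
Jacobian point of `P(ρ̄)(ℚ₂)`. -/
def IsSwitchableAtTwo (v : HeightOneSpectrum (𝓞 ℚ)) (ρb : FramedGaloisRep ℚ (ZMod p) 4) : Prop :=
  ρb.IsUnramifiedAt v ∧
    ∀ Q : Polynomial (ZMod p), ρb.HasFrobCharpolyAt v Q →
      Q ≠ (Polynomial.X ^ 2 + Polynomial.X + 2) ^ 2 ∧ Q ≠ (Polynomial.X ^ 2 - Polynomial.X + 2) ^ 2

variable (p k) in
/-- **`Switchable p k σ σ'`** — the SECTOR hypothesis of the line (meaningful for every `p`, used at
`p = 3`): `σ ⊕ σ'` admits an `𝔽_p`-model `ρb : Γ_ℚ → GL₄(𝔽_p)` which is symplectic with multiplier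
`ε̄⁻¹` (tree `IsSymplecticWithMultiplierFun`), ordinary-with-unramified-sub and peu ramifié at the
place(s) above `p`, and unramified at `2` with `charpoly ρb(Frob₂) ≠ (X² ± X + 2)²` — verbatim the
hypotheses of arXiv:2502.20645 Lemma 9.4.2 ("switching") for `p = 3`. -/
def Switchable (σ σ' : FramedGaloisRep ℚ k 2) : Prop :=
  ∃ ρb : FramedGaloisRep ℚ (ZMod p) 4,
    ρb.IsSymplecticWithMultiplierFun (fun g => (((epsBar p g)⁻¹ : (ZMod p)ˣ) : ZMod p)) ∧
    IsModelOf ρb σ σ' ∧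
    (∀ v : HeightOneSpectrum (𝓞 ℚ), ((p : ℕ) : 𝓞 ℚ) ∈ v.asIdeal → IsOrdinaryFlatAt p v ρb) ∧
    (∀ v : HeightOneSpectrum (𝓞 ℚ), ((2 : ℕ) : 𝓞 ℚ) ∈ v.asIdeal → IsSwitchableAtTwo p v ρb)

end Sector

/-! ## Vocabulary III — abelian surfaces over `ℚ` and their framed `p`-adic `H¹` -/

section Surfaces

variable (p : ℕ) [Fact p.Prime]

/-- `TateFrame p B b ρ₀`: `ρ₀ : Γ_ℚ → GL₄(ℚ̄_p)` IS the contragredient of the rational `p`-adic Tate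
module `V_p(B) ⊗ ℚ̄_p` of the abelian variety `B/ℚ` written in the dual basis of the
`ℚ_p`-basis `b` of `V_p(B)` (tree `AbelianVariety.rationalTateModule`, `AbelianVariety.rationalTateRep`
of `Literature/NumberTheory/DiophantineGeometry/AVGaloisModule.lean`): the matrix of `g` on the dual
in the dual basis is the transpose of the matrix of `g⁻¹`.  So `ρ₀ ≅ H¹_ét(B_ℚ̄, ℚ̄_p)`, BCGP's
`ρ_{B,p}` (cohomological convention, similitude `ε⁻¹`). -/
def TateFrame (B : AbelianVariety ℚ) (b : Module.Basis (Fin 4) ℚ_[p] (B.rationalTateModule p))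
    (ρ₀ : FramedGaloisRep ℚ (PadicAlgCl p) 4) : Prop :=
  ∀ g : Field.absoluteGaloisGroup ℚ,
    (ρ₀ g).val =
      ((LinearMap.toMatrix b b (B.rationalTateRep p g⁻¹)).map (algebraMap ℚ_[p] (PadicAlgCl p))).transpose

/-- `EndTrivial B`: every endomorphism of `B` defined over `ℚ` is multiplication by an integer
(`End_ℚ(B) = ℤ`; implied by BCGP's `End(B_ℚ̄) = ℤ`, and all that Faltings needs for absolute
irreducibility of `V_p(B)`). -/
def EndTrivial (B : AbelianVariety ℚ) : Prop :=
  ∀ f : B ⟶ B, ∃ n : ℤ, f = n • 𝟙 B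

end Surfaces

/-! ## Stub 1a — charpoly congruence on all of `Γ_ℚ` from a common residual pair (global half of the transfer)

LEAD RESHAPE (2026-08-16, line lead): the planner's `stub_distinguishedTransfer` (M/L) is split at the
skeleton level into a GLOBAL half (`stub_charpolyCongruence`: Chebotarev density + continuity, no local
input) and a LOCAL half (`stub_distinguishedTransferLocal`: comparison of residual diagonal characters of
two triangular frames at `v ∣ p`); the composition `distinguishedTransfer` below is proved (sorry-free) and
is what the glue consumes.  Same mathematics, two independently landable lemmas. -/

/-- **Stub 1a (`stub_charpolyCongruence`, M, provable now).**  Two continuous `r, r' : Γ_ℚ → GL₄(ℚ̄_p)`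
with the SAME residual pair `(σ, σ')` through `red` (tree `FramedGaloisRep.HasResidualPair`: at almost all
`v` the Frobenius polynomial is `p`-integral and reduces to `charpoly σ(Frob_v) · charpoly σ'(Frob_v)`) have
congruent characteristic polynomials EVERYWHERE: for every `τ ∈ Γ_ℚ`, `charpoly r(τ)` and `charpoly r'(τ)`
have coefficients in `𝒪 = 𝒪_{ℚ̄_p}` (compact image) and the same image under `red`.
WHY TRUE: (i) `ker red = 𝔪_𝒪` (any ring map from the rank-one valuation ring `𝒪` to a field of
characteristic `p` kills `𝔪`: `‖x‖ < 1 ⇒ x^N ∈ p𝒪 ⇒ red(x)^N = 0`; and `‖x‖ = 1 ⇒ x ∈ 𝒪ˣ ⇒ red x ≠ 0`);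
(ii) integrality of `charpoly r(τ)` for all `τ` (`FramedRep.exists_map_eq_charpoly`, compact `Γ_ℚ`);
(iii) the set `T = {τ | coefficients of charpoly r(τ) - charpoly r'(τ) all have norm < 1}` is CLOSED
(continuity of `τ ↦ r(τ)`, polynomiality of coefficients, `{‖x‖ < 1}` is clopen in the ultrametric `ℚ̄_p`,
Mathlib `IsUltrametricDist.isClosed_ball`/`isOpen_ball`); (iv) `T` contains every arithmetic Frobenius at
every prime above every place outside a finite set `S` (the two `HasResidualPair` clauses: at such `v`,
`charpoly r(Frob) = P`, `charpoly r'(Frob) = P'` with `P̄ = P₁P₂ = P̄'`, the `Pᵢ` being THE Frobenius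
polynomials of `σ, σ'` — `HasFrobCharpolyAt` quantifies over all Frobenii at all `𝔓 ∣ v`); (v) those
Frobenii are DENSE in `Γ_ℚ` (`absoluteGaloisGroup.frobenius_dense chebotarev_artinRep_holds`,
FrobeniusDensity.lean + ChebotarevArtinRepHolds.lean), so `T = Γ_ℚ`.  Size M (~250–400 lines).
LEANS ON: `FramedGaloisRep.HasResidualPair` (ResidualPair.lean), `HasFrobCharpolyAt`,
`FramedRep.exists_map_eq_charpoly`, `FramedRep.map_eq_charpoly_unique`, `HasFrobCharpolyAt.unique`
(ResidualPairIntegrality.lean, proved), `absoluteGaloisGroup.frobenius_dense` (FrobeniusDensity.lean, proved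
modulo `chebotarev_artinRep`, discharged by `chebotarev_artinRep_holds`, ChebotarevArtinRepHolds.lean).
[cite: SerreAbelianLadic1968, Ch. I §2.2 Cor. 2 (a), §2.3; DeligneSerre1974, §6] -/
theorem stub_charpolyCongruence :
    ∀ (p : ℕ) [Fact p.Prime] (k : Type) [Field k] [CharP k p] [TopologicalSpace k]
      (red : Valued.integer (PadicAlgCl p) →+* k)
      (σ σ' : FramedGaloisRep ℚ k 2) (r r' : FramedGaloisRep ℚ (PadicAlgCl p) 4),
      r.HasResidualPair red σ σ' → r'.HasResidualPair red σ σ' →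
      ∀ τ : Field.absoluteGaloisGroup ℚ,
        ∃ P P' : Polynomial (Valued.integer (PadicAlgCl p)),
          P.map (Valued.integer (PadicAlgCl p)).subtype = FramedRep.charpoly r τ ∧
          P'.map (Valued.integer (PadicAlgCl p)).subtype = FramedRep.charpoly r' τ ∧
          P.map red = P'.map red := by
  sorry

/-! ## Stub 1b — residual `p`-distinguishedness transfers along a charpoly congruence (local half) -/

/-- **Stub 1b (`stub_distinguishedTransferLocal`, M/L, provable now).**  Let `p` be odd, `v ∣ p`, and
`r, r' : Γ_ℚ → GL₄(ℚ̄_p)` with congruent characteristic polynomials everywhere (conclusion of Stub 1a).  If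
`r` is residually distinguished of shape `(0,0,1,1)` at `v` and `r'` is Greenberg-ordinary of shape
`(0,0,1,1)` at `v`, then `r'` is residually distinguished of shape `(0,0,1,1)` at `v` — indeed IN ITS
GREENBERG FRAME.
WHY TRUE: write `χ₁,…,χ₄ : Γ_{ℚ_v} → 𝒪ˣ` for the diagonal characters of `r.toLocal v` in the distinguished
frame (inertial values `(1,1,ε⁻¹,ε⁻¹)`, `χ̄₁ ≠ χ̄₂`, `χ̄₃ ≠ χ̄₄`, bars = reduction mod `𝔪 = ker red`) and
`ψ₁,…,ψ₄` for those of `r'.toLocal v` in its Greenberg frame (same inertial values).  For every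
`τ ∈ Γ_{ℚ_v}`: `∏(X - χ̄ᵢ(τ)) = red(charpoly r(τ)) = red(charpoly r'(τ)) = ∏(X - ψ̄ᵢ(τ))` in `k[X]`
(charpoly of a triangular matrix; conjugation invariance), so the semisimple `k`-representations
`⊕ χ̄ᵢ` and `⊕ ψ̄ᵢ` of `Γ_{ℚ_v}` have equal characteristic polynomials and are isomorphic by Brauer–Nesbitt
(tree `Representation.nonempty_equiv_of_charpoly_eq`, any monoid, proved), whence the MULTISETS of
characters agree: `{χ̄ᵢ} = {ψ̄ᵢ}`.  For `p` odd, `ε̄ ≠ 1` on the inertia group `I_{ℚ_v}` (tree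
`adicCompletion_rat_exists_mem_absInertia_cyclotomicCharacter_eq`: `χ_p(I_{ℚ_v}) = ℤ_pˣ ∋ -1`), so the
unramified characters `χ̄₁, χ̄₂` cannot equal the ramified `ψ̄₃, ψ̄₄` and vice versa: `{ψ̄₁, ψ̄₂} = {χ̄₁, χ̄₂}`
(distinct) and `{ψ̄₃, ψ̄₄} = {χ̄₃, χ̄₄}` (distinct).  Finally `ψ̄ᵢ(τ) ≠ ψ̄ⱼ(τ)` iff `‖ψᵢ(τ) - ψⱼ(τ)‖ = 1`
(`ker red = 𝔪`), which is the defining clause of `IsResiduallyDistinguishedOfShape` in the Greenberg frame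
(that frame is triangular with the right inertial diagonal).  Size M/L (~400–700 lines).
LEANS ON: `FramedRep.IsResiduallyDistinguishedOfShape` / `IsGreenbergOrdinaryOfShape` + `…At_iff`,
`IsUpperTriangular.diagChar`, `norm_diagEntry_eq_one`, `norm_diagEntry_sub_eq_one_iff`
(CrystallineOrdinaryShape.lean), `Representation.nonempty_equiv_of_charpoly_eq` (Brauer–Nesbitt, proved),
`adicCompletion_rat_exists_mem_absInertia_cyclotomicCharacter_eq` (LocalKroneckerWeberInertiaProofs.lean),
`FramedGaloisRep.toLocal`.
[cite: BoxerEtAl2021, §7.3 (p-distinguished); SerreAbelianLadic1968, Ch. I §2.3] -/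
theorem stub_distinguishedTransferLocal :
    ∀ (p : ℕ) [Fact p.Prime], p ≠ 2 → ∀ (k : Type) [Field k] [CharP k p]
      (red : Valued.integer (PadicAlgCl p) →+* k)
      (r r' : FramedGaloisRep ℚ (PadicAlgCl p) 4) (v : HeightOneSpectrum (𝓞 ℚ)),
      ((p : ℕ) : 𝓞 ℚ) ∈ v.asIdeal →
      (∀ τ : Field.absoluteGaloisGroup ℚ,
        ∃ P P' : Polynomial (Valued.integer (PadicAlgCl p)),
          P.map (Valued.integer (PadicAlgCl p)).subtype = FramedRep.charpoly r τ ∧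
          P'.map (Valued.integer (PadicAlgCl p)).subtype = FramedRep.charpoly r' τ ∧
          P.map red = P'.map red) →
      r.IsResiduallyDistinguishedAt v ![0, 0, 1, 1] →
      r'.IsGreenbergOrdinaryOfShapeAt v ![0, 0, 1, 1] →
      r'.IsResiduallyDistinguishedAt v ![0, 0, 1, 1] := by
  sorry

/-- **Stub 1 assembled (sorry-free glue): residual `p`-distinguishedness is a property of the residual
pair.**  `p` odd, `r, r'` with the same residual pair `(σ, σ')` through `red`, `r` residually distinguished
and `r'` Greenberg-ordinary of shape `(0,0,1,1)` at `v ∣ p` ⇒ `r'` residually distinguished at `v`.  This is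
where the crux's load-bearing hypothesis H5 (`∃ ρ, Sh ρ`) is consumed: `r :=` the H5-witness, `r' := ρ₀`. -/
theorem distinguishedTransfer
    (p : ℕ) [Fact p.Prime] (hp : p ≠ 2) (k : Type) [Field k] [CharP k p] [TopologicalSpace k]
    (red : Valued.integer (PadicAlgCl p) →+* k)
    (σ σ' : FramedGaloisRep ℚ k 2) (r r' : FramedGaloisRep ℚ (PadicAlgCl p) 4)
    (v : HeightOneSpectrum (𝓞 ℚ)) (hv : ((p : ℕ) : 𝓞 ℚ) ∈ v.asIdeal)
    (hr : r.HasResidualPair red σ σ') (hr' : r'.HasResidualPair red σ σ')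
    (hdist : r.IsResiduallyDistinguishedAt v ![0, 0, 1, 1])
    (hGr' : r'.IsGreenbergOrdinaryOfShapeAt v ![0, 0, 1, 1]) :
    r'.IsResiduallyDistinguishedAt v ![0, 0, 1, 1] :=
  stub_distinguishedTransferLocal p hp k red r r' v hv
    (stub_charpolyCongruence p k red σ σ' r r' hr hr') hdist hGr'

/-! ## Stub 2 — the 2–3 switch lands on a MODULAR abelian surface (hardest; in print) -/

/-- **Stub 2 (`stub_switchToModularSurface`, XL, the lever; a THEOREM IN PRINT modulo typing).**
At `p = 3`: if `σ ⊕ σ'` has a switchable `GSp₄(𝔽₃)`-model `ρb` (`Switchable 3 k σ σ'`: symplectic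
`ε̄⁻¹`; ordinary-with-unramified-sub and peu ramifié at `3`; unramified at `2` with
`charpoly(Frob₂) ≠ (X² ± X + 2)²`), then there is an abelian surface `B/ℚ` with a `ℚ_3`-basis `b`
of `V_3(B)` and the framed contragredient `ρ₀ = H¹_ét(B_ℚ̄, ℚ̄₃)` (`TateFrame`) such that:
`dim B = 2`; `B` has GOOD ORDINARY reduction at `3` (tree `AbelianVariety.HasGoodOrdinaryReductionAt`);
`End_ℚ(B) = ℤ`; `ρ₀` is symplectic with multiplier `ε⁻¹`; `ρ₀` has residual pair `(σ, σ')` through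
`red`; and `ρ₀` is AUTOMORPHIC on `GL₄(𝔸_ℚ)` for every `ι : ℚ̄₃ ≃ ℂ` (`AutGL4`).
WHY TRUE (arXiv:2502.20645, pages read: pp. 134–137 of the held text): Lemma 9.4.2 ("switching";
held-text Lemma 416) — hypotheses: similitude `ε̄⁻¹`, `ρ̄^∨|_{G_{ℚ₃}}` ordinary and finite flat
(= `IsOrdinaryFlatAt`, see its docstring), `ρ̄|_{G_{ℚ₂}}` unramified with `Frob₂ ∉ 4C, 12C`
(⟺ `charpoly ≠ (x² ± x + 2)²`, Thm 9.5.2 (2)); NO irreducibility / big-image hypothesis on `ρ̄`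
(Remark 9.4.4) — gives `X/ℚ` of genus 2 with a rational Weierstrass point, `B = Jac(X)`,
`ρ̄_{B,3} ≅ ρ̄` SYMPLECTICALLY, good ordinary at `3`, `im ρ̄_{B,2} = S₅(b)`, `End(B_ℚ̄) = ℤ` (Zarhin).  Then
EXACTLY as in the first half of the proof of Thm 9.5.2 (held-text Thm 420): the 2-adic §8.3 main Theorem
(held-text Thm 386; hypotheses at `2` only, reducible `ρ̄_{B,3}` allowed) makes `B` modular, of general
type because `ρ_{B,3}` is irreducible (`End = ℤ`), with cuspidal transfer to `GL₄` (Arthur 2004 /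
Gee–Taïbi 2019).  Remaining dictionary (inside this stub): Weil pairing ⇒ symplectic `ε⁻¹`; `ρ̄_{B,3} ≅ ρ̄`
+ `IsModelOf` ⇒ `HasResidualPair red σ σ'` (`Matrix.charpoly_fromBlocks_zero₁₂`,
`hasResidualPair_of_frobenius`); `Π` L-algebraic cuspidal with `arithFrobPolyOfSatake ι q_v 1` matching.
WHY IT MIGHT FAIL: typing only — (a) peu-ramifié vs finite flat; (b) contragredient convention (`TateFrame`);
(c) the automorphic dictionary.  In Lean this stub closes only modulo NAMED FACTS to be filed as cite items
(BCGP2025 Lemma 9.4.2 + Rem 9.4.3; BCGP2025 §8.3 main Theorem; Arthur/Gee–Taïbi transfer; Weil pairing).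
Size XL (the facts) + L (the dictionary, ~800 lines).
LEANS ON: `AbelianVariety`, `rationalTateModule`, `rationalTateRep`, `HasGoodOrdinaryReductionAt`,
`IsSymplecticWithMultiplierFun`, `HasResidualPair`, `hasResidualPair_of_frobenius`,
`CuspidalAutomorphicRepData`, `arithFrobPolyOfSatake`; Disproof §5 R2.
[cite: BoxerCalegariGeePilloni2025, Lemma 9.4.2, Remark 9.4.3–9.4.4, §8.3 main Theorem (held-text Thm 386), Thm 9.5.2 (arXiv:2502.20645 pp. 124, 134–137);
BoxerEtAl2021, §10.2; BruinFilatov2022, arXiv:2207.04393 Thm 1.2; Zarhin2000; Arthur2004; GeeTaibi2019; MumfordAV1970, §20] -/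
theorem stub_switchToModularSurface :
    ∀ (p : ℕ) [Fact p.Prime], p = 3 → ∀ (k : Type) [Field k] [CharP k p] [IsAlgClosed k]
      [TopologicalSpace k] [DiscreteTopology k] (red : Valued.integer (PadicAlgCl p) →+* k)
      (σ σ' : FramedGaloisRep ℚ k 2),
      Switchable p k σ σ' →
      ∃ (B : AbelianVariety ℚ) (b : Module.Basis (Fin 4) ℚ_[p] (B.rationalTateModule p))
        (ρ₀ : FramedGaloisRep ℚ (PadicAlgCl p) 4),
        TateFrame p B b ρ₀ ∧ B.dim = 2 ∧
        (∀ v : HeightOneSpectrum (𝓞 ℚ), ((p : ℕ) : 𝓞 ℚ) ∈ v.asIdeal → B.HasGoodOrdinaryReductionAt v) ∧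
        EndTrivial B ∧
        ρ₀.IsSymplecticWithMultiplierFun (fun g => algebraMap ℚ_[p] (PadicAlgCl p)
          ((((GaloisRep.cyclotomicCharacter ℚ p g)⁻¹ : ℤ_[p]ˣ) : ℤ_[p]) : ℚ_[p])) ∧
        ρ₀.HasResidualPair red σ σ' ∧
        ∀ (hcpt : isCompact_glFiniteIntegralLevel 4 ℚ) (ι : PadicAlgCl p ≃+* ℂ),
          ∃ π : CuspidalAutomorphicRepData 4 ℚ hcpt, π.1.IsLAlgebraic ∧
            ∀ᶠ v : HeightOneSpectrum (𝓞 ℚ) in Filter.cofinite,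
              ∃ a : Multiset ℂ, π.1.HasSatakeParamAt v a ∧ ρ₀.IsUnramifiedAt v ∧
                ρ₀.HasFrobCharpolyAt v (arithFrobPolyOfSatake ι v.residueCard 1 a) := by
  sorry

/-! ## Stub 3 — the Tate-module dictionary, split by the lead into its two named-fact dependencies

LEAD RESHAPE (2026-08-16): the planner's `stub_tateModuleDictionary` (L) is split into
`stub_tateModuleIrreducible` (Faltings: depends on the EXISTING tree named facts `faltings_tate_bijective`,
`isSemisimpleRepresentation_rationalTateRep`) and `stub_tateModuleGreenberg` (Serre–Tate: needs a NEW cite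
fact, "good ordinary ⇒ ordinary Tate module", explicitly "not recorded" in
AbelianVarietyOrdinaryReduction.lean); the composition `tateModuleDictionary` is proved below.  The two
stub signatures INLINE `TateFrame` / `EndTrivial` (definitionally, so the glue applies them to the named
hypotheses unchanged) so that the stub files under `Theorems/` mention only Mathlib + Literature and never
re-declare line vocabulary. -/

/-- **Stub 3i (`stub_tateModuleIrreducible`, M/L modulo Faltings).**  `B/ℚ` an abelian variety with
`End_ℚ(B) = ℤ` (`EndTrivial`), `ρ₀` its framed `p`-adic `H¹` in the dual basis of a `ℚ_p`-basis `b` of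
`V_p(B)` (`TateFrame`; the basis has `4` elements, so `dim B = 2` is implicit and not assumed).  Then `ρ₀`
is (absolutely) irreducible.
WHY TRUE: Faltings — `V_p(B)` is a semisimple `ℚ_p[Γ_ℚ]`-module and `End_ℚ(B) ⊗ ℚ_p ≅ End_{Γ_ℚ}(V_p B)`
(tree NAMED FACTS `isSemisimpleRepresentation_rationalTateRep`, `faltings_tate_bijective`, FaltingsAbelian*.lean);
with `End_ℚ(B) = ℤ` the commutant is `ℚ_p`, a semisimple module whose commutant is the (perfect) ground
field is absolutely irreducible, so `V_p(B) ⊗ ℚ̄_p` is irreducible, and so is its dual = `ρ₀` (transpose-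
inverse frame; tree FramedRepDualIrreducible.lean).  In Lean: prove it outright if the two Faltings facts
have `_holds` discharges, otherwise prove the version taking them as hypotheses (conditional result) and
report `stub-blocked: faltings_tate_bijective`.  Size M/L (matrix bookkeeping `LinearMap.toMatrix`,
base change of irreducibility).
LEANS ON: `AbelianVariety.rationalTateRep`, `faltings_tate_bijective`, `isSemisimpleRepresentation_rationalTateRep`
(named facts), `GaloisRep.IsIrreducible`, FramedRepDualIrreducible.lean, FramedRepBaseChange.lean.
[cite: Faltings1983, Satz 3–4] -/
theorem stub_tateModuleIrreducible :
    ∀ (p : ℕ) [Fact p.Prime] (B : AbelianVariety ℚ)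
      (b : Module.Basis (Fin 4) ℚ_[p] (B.rationalTateModule p)) (ρ₀ : FramedGaloisRep ℚ (PadicAlgCl p) 4),
      (∀ g : Field.absoluteGaloisGroup ℚ,
        (ρ₀ g).val =
          ((LinearMap.toMatrix b b (B.rationalTateRep p g⁻¹)).map
            (algebraMap ℚ_[p] (PadicAlgCl p))).transpose) →
      (∀ f : B ⟶ B, ∃ n : ℤ, f = n • 𝟙 B) →
      ρ₀.toGaloisRep.IsIrreducible := by
  sorry

/-- **Stub 3ii (`stub_tateModuleGreenberg`, L modulo Serre–Tate).**  `B/ℚ` an abelian SURFACE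
(`dim B = 2`) with good ordinary reduction at the place `v ∣ p`, `ρ₀` its framed `p`-adic `H¹`
(`TateFrame`).  Then `ρ₀` is Greenberg-ordinary of shape `(0,0,1,1)` at `v`.
WHY TRUE: Serre–Tate / Grothendieck: for good ORDINARY reduction the connected–étale sequence of the
`p`-divisible group of the abelian-scheme model gives `0 → T_p(B^μ) → T_p(B) → T_p(B^ét) → 0` over
`Γ_{ℚ_v}` with `T_p(B^μ) ≅ ℤ_p(1) ⊗ (unramified)` of rank `dim B = 2` and `T_p(B^ét)` unramified of rank
`2`; dualising, `ρ₀ = V_p(B)^∨` has an UNRAMIFIED rank-2 sub with quotient `ε⁻¹ ⊗ unramified` — a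
block-triangular frame with inertia `(1, 1, ε⁻¹, ε⁻¹)` scalar on the blocks = `IsGreenbergOrdinaryOfShape
![0,0,1,1]` (unramified block FIRST, the crux's orientation).  In Lean the Galois-side description of
ordinary reduction is NOT in the tree ("a theorem, not recorded", AbelianVarietyOrdinaryReduction.lean):
state it inline as a cite fact over `rationalTateRep` / `toLocal` / `absInertia` /
`GaloisRep.cyclotomicCharacter` (`[cite: SerreTate1968, §1; MumfordAV1970, §18]`,
`[topic NumberTheory/DiophantineGeometry]`), prove the frame dictionary from it, and report the fact name.
Size L (or M modulo the cite fact).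
LEANS ON: `AbelianVariety.HasGoodOrdinaryReductionAt`, `hasGoodOrdinaryReductionAt_iff`, `rationalTateRep`,
`FramedRep.IsGreenbergOrdinaryOfShape` API, `FramedGaloisRep.toLocal`.
[cite: SerreTate1968, §1; MumfordAV1970, §18–§19; BoxerEtAl2021, §2.6–§7.3] -/
theorem stub_tateModuleGreenberg :
    ∀ (p : ℕ) [Fact p.Prime] (B : AbelianVariety ℚ)
      (b : Module.Basis (Fin 4) ℚ_[p] (B.rationalTateModule p)) (ρ₀ : FramedGaloisRep ℚ (PadicAlgCl p) 4),
      (∀ g : Field.absoluteGaloisGroup ℚ,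
        (ρ₀ g).val =
          ((LinearMap.toMatrix b b (B.rationalTateRep p g⁻¹)).map
            (algebraMap ℚ_[p] (PadicAlgCl p))).transpose) →
      B.dim = 2 →
      ∀ v : HeightOneSpectrum (𝓞 ℚ), ((p : ℕ) : 𝓞 ℚ) ∈ v.asIdeal → B.HasGoodOrdinaryReductionAt v →
        ρ₀.IsGreenbergOrdinaryOfShapeAt v ![0, 0, 1, 1] := by
  sorry

/-- **Stub 3 assembled (sorry-free glue): the Tate-module dictionary.**  An ordinary abelian surface with
`End_ℚ = ℤ` has irreducible, Greenberg-ordinary `(0,0,1,1)` framed `H¹`. -/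
theorem tateModuleDictionary
    (p : ℕ) [Fact p.Prime] (B : AbelianVariety ℚ)
    (b : Module.Basis (Fin 4) ℚ_[p] (B.rationalTateModule p)) (ρ₀ : FramedGaloisRep ℚ (PadicAlgCl p) 4)
    (hfr : TateFrame p B b ρ₀) (hdim : B.dim = 2)
    (hord : ∀ v : HeightOneSpectrum (𝓞 ℚ), ((p : ℕ) : 𝓞 ℚ) ∈ v.asIdeal → B.HasGoodOrdinaryReductionAt v)
    (hEnd : EndTrivial B) :
    ρ₀.toGaloisRep.IsIrreducible ∧
      ∀ v : HeightOneSpectrum (𝓞 ℚ), ((p : ℕ) : 𝓞 ℚ) ∈ v.asIdeal →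
        ρ₀.IsGreenbergOrdinaryOfShapeAt v ![0, 0, 1, 1] :=
  ⟨stub_tateModuleIrreducible p B b ρ₀ hfr hEnd,
    fun v hv => stub_tateModuleGreenberg p B b ρ₀ hfr hdim v hv (hord v hv)⟩

/-! ## Stub 4 — the HONEST REMAINDER: the crux off the `p = 3` switchable sector (not claimed) -/

/-- **Stub 4 (`stub_offSectorRemainder`, OPEN — the remainder this line does NOT attack).**  For data
outside the sector — every odd `p ≠ 3`, and at `p = 3` every pair `(σ, σ')` with no switchable
`GSp₄(𝔽₃)`-model (no `𝔽₃`-model at all, e.g. `σ̄` genuinely over `𝔽₉` with `σ̄' ≠ σ̄^(3)`; or très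
ramifié / non-ordinary-direction at `3`; or ramified at `2` / `Frob₂ ∈ 4C ∪ 12C`) — the crux
`CruxAt p k red σ σ'` as filed.  This is EXACTLY the crux restricted off the sector: regimes R4
(generic `p ≥ 5`, `A₂(p)`-twists of general type — Hulek–Sankaran — so no Diophantine supply),
the dihedral D-residue and the `p = 3` leftovers of Disproof.lean §5; TRUE but settled elsewhere on
R1/D1 (functorial pairs, `cruxAt_of_automorphic_lift`).  Expected dimension `-1` (Disproof §6): no
engine is proposed here.  The lead should NOT try to prove it inside this line: hand it back
(`promote-stub`) — it is the natural second child of a planner split of the crux into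
"`p = 3` switchable sector" (this line, closable modulo cited facts) + "the rest" (to be attacked by
`serre-dual-ribet-square`'s coherent Ribet square, or restated to `Irr'` by the tenure planner,
Disproof `closes_irr'`, triage r1-1/2/3 bottom lines).
WHY IT MIGHT FAIL: it is the open problem itself (singular-weight deficit); a RIGID PAIR (Disproof
§3.4) off the sector refutes it and the crux with it.  Size: open (XL⁺).
[cite: HulekSankaran2002 (Kodaira dimension of A₂(p)); Sorensen2006; Sorensen2009; LemmaOchiai2023; HsiehPalvannan2025;
DeoPalvannan2026 arXiv:2602.20737] -/
theorem stub_offSectorRemainder :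
    ∀ (p : ℕ) [Fact p.Prime], p ≠ 2 → ∀ (k : Type) [Field k] [CharP k p] [IsAlgClosed k]
      [TopologicalSpace k] [DiscreteTopology k] (red : Valued.integer (PadicAlgCl p) →+* k)
      (σ σ' : FramedGaloisRep ℚ k 2),
      ¬ (p = 3 ∧ Switchable p k σ σ') → CruxAt p k red σ σ' := by
  sorry

/-! ## Glue (sorry-free): the crux from the six stubs -/

/-- **`StableYoshidaCongruence` from the line `level-three-weierstrass-switch`.**  Regime split on
the sector `p = 3 ∧ Switchable p k σ σ'`.  IN the sector: the 2–3 switch (Stub 2) produces a modular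
abelian surface `B` with framed `H¹ = ρ₀`, symplectic, residual pair `(σ, σ')`, automorphic; the
Tate-module dictionary (Stubs 3i/3ii) makes `ρ₀` irreducible and Greenberg-ordinary `(0,0,1,1)` at `3`;
residual distinguishedness is transferred from the H5-witness (Stubs 1a/1b); so `ρ₀` witnesses `CruxAt`.
OFF the sector: Stub 4 (the honest remainder).  `AutGL2`, `DetCond`, `NonConj` are threaded only into
Stub 4. -/
theorem StableYoshidaCongruence_of : StableYoshidaCongruence := by
  refine crux_iff.mpr fun p _ hp k _ _ _ _ _ red σ σ' => ?_
  by_cases hsec : p = 3 ∧ Switchable p k σ σ'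
  · obtain ⟨hp3, hsw⟩ := hsec
    intro hA hA' hirr hirr' hdet hnc hw hcpt ι
    obtain ⟨ρw, hSw⟩ := hw
    obtain ⟨B, b, ρ₀, hfr, hdim, hord, hEnd, hsymp, hpair, hAut⟩ :=
      stub_switchToModularSurface p hp3 k red σ σ' hsw
    obtain ⟨hirr₀, hGr⟩ := tateModuleDictionary p B b ρ₀ hfr hdim hord hEnd
    refine ⟨ρ₀, hirr₀, ⟨hsymp, fun v hv => ⟨hGr v hv, ?_⟩, hpair⟩, hAut hcpt ι⟩
    exact distinguishedTransfer p hp k red σ σ' ρw ρ₀ v hv hSw.2.2 hpair (hSw.2.1 v hv).2 (hGr v hv)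
  · exact stub_offSectorRemainder p hp k red σ σ' hsec

end Summit.Langlands.Langlands.Cruxes.StableYoshidaCongruence.LevelThreeWeierstrassSwitch
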